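import Literature.MathematicalPhysics.QuantumLattice.HubbardUVSymbolSmooth
import Literature.MathematicalPhysics.QuantumLattice.HubbardSliceSymbolSmooth
import Mathlib.Analysis.Calculus.MeanValue
import HarnessLib

/-!
# The RESUMMED ultraviolet symbol `Ψ̃ = Ψ/(1 + Ψ·K/c) = c·w/(−iω + ξ − (1 − w)K)` and its Lipschitz response to the frame value `K`

Topic `MathematicalPhysics/QuantumLattice`; sequel of `HubbardUVSymbolSmooth.lean` (`uvSymbolFn c Λ e ω = w·c/(−iω+e)`, `w = uvWeightFn Λ e ω =
χ₂((ω²+e²)/Λ²)`).  Absorbing a quadratic counterterm `K ψ⁺ψ⁻` into a Gaussian measure of covariance symbol `Ψ` replaces `Ψ` by the RESUMMED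
symbol `Ψ̃ = Ψ/(1 + Ψ·K/c)` (Benfatto–Giuliani–Mastropietro 2006, (2.23): «`E_{h−1}(k) = E_h(k) + C_h^{−1}(k) n̂_h(k)`» — the dispersion seen
by the remaining fields is shifted by the cutoff-weighted counterterm; Salmhofer 1999 §4.2.5 (4.70) for `Ψ`).  With `e = ξ − K`:

  `Ψ̃ = c·w/(−iω + ξ − (1 − w)·K)`   (`uvResummedFn_eq`),

so `Ψ̃ = 0` where `w = 0` (below the shell) and `Ψ̃ = c/(−iω + ξ)` — INDEPENDENT of `K` — where `w = 1` (above the shell): the frame acts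
only on the transition shell.  Main estimate (derivative-free case analysis): for `|K|, |K′| ≤ Λ/4`, `ω ≠ 0`,

  `‖Ψ̃(K) − Ψ̃(K′)‖ ≤ c·(200 + 200·B₁)/Λ² · |K − K′|`   (`norm_uvResummedFn_sub_le`, `B₁ ≥ sup|χ₂′|`),

the symbol half of the two-frame response of a single-scale step (cell gate-hubbard-kl: the shell sum `Σ_p ‖s_K(p) − s_{K′}(p)‖` and the
pointwise `‖s_K(q) − s_{K′}(q)‖` of `…EngineCovarianceResponseAtPoint.covResp_norm_selfEnergy_sub_le`; and the frame-shift step of a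
flowing-dispersion scheme).  Everything is proved; one definition (`uvResummedFn`).

## Sources

G. Benfatto, A. Giuliani, V. Mastropietro, Ann. Henri Poincaré 7 (2006) 809–898, §2.2 (2.23), (2.27)–(2.28) [`BenfattoGiulianiMastropietro2006`];
M. Salmhofer, *Renormalization* (Springer 1999), §4.2.5 (4.70)–(4.71) [`Salmhofer1999`].
-/

noncomputable section

namespace Literature.MathematicalPhysics.QuantumLattice

open Complex

/-- **The resummed ultraviolet symbol** at frame value `x = K(p)` and free band value `ξ` (so `e_K = ξ − x`):
`Ψ̃ = Ψ/(1 + Ψ·x/c)`, `Ψ = uvSymbolFn c Λ (ξ − x) ω`. [cite: BenfattoGiulianiMastropietro2006, §2.2 (2.23)] -/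
def uvResummedFn (c Λ ω ξ x : ℝ) : ℂ :=
  uvSymbolFn c Λ (ξ - x) ω / (1 + uvSymbolFn c Λ (ξ - x) ω * ((x / c : ℝ) : ℂ))

/-- The bare denominator `−iω + e` does not vanish at a nonzero (fermionic) frequency. [cite: BenfattoGiulianiMastropietro2006, §2.1 (2.3)] -/
theorem uvDen_ne_zero {ω : ℝ} (hω : ω ≠ 0) (e : ℝ) : -I * ((ω + 0 : ℝ) : ℂ) + (e : ℂ) ≠ 0 := by
  intro h
  have := congrArg Complex.im h
  simp at this
  exact hω this

/-- **The resummed symbol in closed form**: `Ψ̃ = c·w/(−iω + ξ − (1 − w)x)`, `w = uvWeightFn Λ (ξ−x) ω` (`c ≠ 0`, `ω ≠ 0`).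
[cite: BenfattoGiulianiMastropietro2006, §2.2 (2.23)] -/
theorem uvResummedFn_eq {c ω : ℝ} (hc : c ≠ 0) (hω : ω ≠ 0) (Λ ξ x : ℝ) :
    uvResummedFn c Λ ω ξ x =
      (c : ℂ) * (uvWeightFn Λ (ξ - x) ω : ℂ) / (-I * (ω : ℂ) + (ξ : ℂ) - (1 - (uvWeightFn Λ (ξ - x) ω : ℂ)) * (x : ℂ)) := by
  have hD : -I * ((ω + 0 : ℝ) : ℂ) + ((ξ - x : ℝ) : ℂ) ≠ 0 := uvDen_ne_zero hω _
  have hc' : (c : ℂ) ≠ 0 := by exact_mod_cast hc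
  unfold uvResummedFn uvSymbolFn resolventFn
  set w : ℝ := uvWeightFn Λ (ξ - x) ω
  have hD2 : -I * (ω : ℂ) + (ξ : ℂ) - (1 - (w : ℂ)) * (x : ℂ) ≠ 0 := by
    intro h
    have := congrArg Complex.im h
    simp at this
    exact hω this
  have hD' : -(I * (ω : ℂ)) + (ξ : ℂ) - (x : ℂ) ≠ 0 := by
    intro h
    have := congrArg Complex.im h
    simp at this
    exact hω this
  have hD'' : -(I * (ω : ℂ)) + ((ξ : ℂ) - (x : ℂ)) ≠ 0 := by rwa [← add_sub_assoc]
  have key : (1 : ℂ) + (w : ℂ) * ((c : ℂ) / (-I * ((ω + 0 : ℝ) : ℂ) + ((ξ - x : ℝ) : ℂ))) * ((x / c : ℝ) : ℂ) =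
      (-I * (ω : ℂ) + (ξ : ℂ) - (1 - (w : ℂ)) * (x : ℂ)) / (-I * ((ω + 0 : ℝ) : ℂ) + ((ξ - x : ℝ) : ℂ)) := by
    rw [eq_div_iff hD]
    push_cast
    simp only [add_zero, neg_mul]
    field_simp
    ring
  rw [key, div_div_eq_mul_div, mul_assoc, div_mul_cancel₀ _ hD]
  ring

/-- Below the shell (`w = 0`) the resummed symbol vanishes. [cite: BenfattoGiulianiMastropietro2006, §2.2 (2.27)–(2.28)] -/
theorem uvResummedFn_eq_zero_of_weight {c ω : ℝ} (hc : c ≠ 0) (hω : ω ≠ 0) {Λ ξ x : ℝ} (hw : uvWeightFn Λ (ξ - x) ω = 0) :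
    uvResummedFn c Λ ω ξ x = 0 := by
  rw [uvResummedFn_eq hc hω, hw]; simp

/-- Above the shell (`w = 1`) the resummed symbol is the BARE resolvent `c/(−iω + ξ)`, independent of the frame value.
[cite: BenfattoGiulianiMastropietro2006, §2.2 (2.27)–(2.28)] -/
theorem uvResummedFn_eq_of_weight_one {c ω : ℝ} (hc : c ≠ 0) (hω : ω ≠ 0) {Λ ξ x : ℝ} (hw : uvWeightFn Λ (ξ - x) ω = 1) :
    uvResummedFn c Λ ω ξ x = (c : ℂ) / (-I * (ω : ℂ) + (ξ : ℂ)) := by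
  rw [uvResummedFn_eq hc hω, hw]; simp

/-- Two frames both above the shell see the same symbol. [cite: BenfattoGiulianiMastropietro2006, §2.2 (2.27)–(2.28)] -/
theorem uvResummedFn_sub_eq_zero_of_weights_one {c ω : ℝ} (hc : c ≠ 0) (hω : ω ≠ 0) {Λ ξ x x' : ℝ}
    (hw : uvWeightFn Λ (ξ - x) ω = 1) (hw' : uvWeightFn Λ (ξ - x') ω = 1) :
    uvResummedFn c Λ ω ξ x - uvResummedFn c Λ ω ξ x' = 0 := by
  rw [uvResummedFn_eq_of_weight_one hc hω hw, uvResummedFn_eq_of_weight_one hc hω hw', sub_self]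

/-- The weight vanishes on the inner region `ω² + e² ≤ Λ²/4`. [cite: Salmhofer1999, §4.2.5 (4.71)] -/
theorem uvWeightFn_eq_zero_of_le {Λ : ℝ} (hΛ : 0 < Λ) {e ω : ℝ} (h : ω ^ 2 + e ^ 2 ≤ Λ ^ 2 / 4) : uvWeightFn Λ e ω = 0 := by
  unfold uvWeightFn
  apply salmhoferCutoff_of_le
  rw [div_le_iff₀ (by positivity)]
  linarith

/-- The weight is `1` on the outer region `ω² + e² ≥ Λ²`. [cite: Salmhofer1999, §4.2.5 (4.71)] -/
theorem uvWeightFn_eq_one_of_ge {Λ : ℝ} (hΛ : 0 < Λ) {e ω : ℝ} (h : Λ ^ 2 ≤ ω ^ 2 + e ^ 2) : uvWeightFn Λ e ω = 1 := by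
  unfold uvWeightFn
  apply salmhoferCutoff_of_ge
  rw [le_div_iff₀ (by positivity)]
  linarith

/-- **Lipschitz bound of the weight in the band value**: `|w(e) − w(e′)| ≤ B₁·|e² − e′²|/Λ²` for `B₁ ≥ sup|χ₂′|`.
[cite: Salmhofer1999, §4.2.5 (4.71)] -/
theorem abs_uvWeightFn_sub_le {B₁ : ℝ} (hB : ∀ y, |deriv salmhoferCutoff y| ≤ B₁) {Λ : ℝ} (hΛ : 0 < Λ) (e e' ω : ℝ) :
    |uvWeightFn Λ e ω - uvWeightFn Λ e' ω| ≤ B₁ * |e ^ 2 - e' ^ 2| / Λ ^ 2 := by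
  unfold uvWeightFn
  have hlip : ∀ a b : ℝ, |salmhoferCutoff a - salmhoferCutoff b| ≤ B₁ * |a - b| := by
    intro a b
    have h := Convex.norm_image_sub_le_of_norm_deriv_le (f := salmhoferCutoff) (s := Set.univ) (C := B₁)
      (fun y _ => (contDiff_salmhoferCutoff (n := 2)).differentiable (by norm_num) y)
      (fun y _ => by rw [Real.norm_eq_abs]; exact hB y) convex_univ (Set.mem_univ b) (Set.mem_univ a)
    simpa [Real.norm_eq_abs] using h
  refine (hlip _ _).trans (le_of_eq ?_)
  rw [show (ω ^ 2 + e ^ 2) / Λ ^ 2 - (ω ^ 2 + e' ^ 2) / Λ ^ 2 = (e ^ 2 - e' ^ 2) / Λ ^ 2 by ring, abs_div,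
    abs_of_pos (by positivity : (0 : ℝ) < Λ ^ 2), mul_div_assoc]

/-- **The resummed denominator stays away from zero on the closed shell**: for `|x| ≤ Λ/4`, `w ∈ [0,1]` and `ω² + (ξ − x)² ≥ Λ²/4`,
`‖−iω + ξ − (1 − w)x‖ ≥ Λ/10`. [cite: BenfattoGiulianiMastropietro2006, §2.2 (2.27)–(2.28)] -/
theorem norm_resummedDen_ge {Λ : ℝ} (hΛ : 0 < Λ) {ω ξ x w : ℝ} (hx : |x| ≤ Λ / 4) (hw0 : 0 ≤ w) (hw1 : w ≤ 1)
    (hshell : Λ ^ 2 / 4 ≤ ω ^ 2 + (ξ - x) ^ 2) :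
    Λ / 10 ≤ ‖-I * (ω : ℂ) + (ξ : ℂ) - (1 - (w : ℂ)) * (x : ℂ)‖ := by
  set z : ℂ := -I * (ω : ℂ) + (ξ : ℂ) - (1 - (w : ℂ)) * (x : ℂ) with hz
  have hre : z.re = ξ - (1 - w) * x := by simp [hz]
  have him : z.im = -ω := by simp [hz]
  by_cases hω : Λ ^ 2 / 8 ≤ ω ^ 2
  · have h1 : |ω| ≤ ‖z‖ := by rw [← abs_neg, ← him]; exact Complex.abs_im_le_norm z
    have h2 : Λ / 10 ≤ |ω| := by
      rw [← Real.sqrt_sq (by positivity : (0:ℝ) ≤ Λ / 10), ← Real.sqrt_sq_eq_abs]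
      exact Real.sqrt_le_sqrt (by nlinarith)
    exact h2.trans h1
  · push Not at hω
    have h3 : Λ ^ 2 / 8 ≤ (ξ - x) ^ 2 := by linarith
    have h1 : |ξ - (1 - w) * x| ≤ ‖z‖ := by rw [← hre]; exact Complex.abs_re_le_norm z
    -- `|ξ − x| ≥ 25Λ/71` since `(25/71)² ≤ 1/8`
    have habs : 25 * Λ / 71 ≤ |ξ - x| := by
      have hsq : (25 * Λ / 71) ^ 2 ≤ (ξ - x) ^ 2 := by nlinarith
      have h := Real.sqrt_le_sqrt hsq
      rwa [Real.sqrt_sq (by positivity), Real.sqrt_sq_eq_abs] at h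
    -- `|ξ − (1−w)x| ≥ |ξ − x| − w|x| ≥ 25Λ/71 − Λ/4 ≥ Λ/10`
    have h4 : |ξ - x| - w * |x| ≤ |ξ - (1 - w) * x| := by
      have : ξ - (1 - w) * x = (ξ - x) + w * x := by ring
      rw [this]
      have h5 := abs_sub_abs_le_abs_sub (ξ - x) (-(w * x))
      rw [sub_neg_eq_add, abs_neg, abs_mul, abs_of_nonneg hw0] at h5
      linarith [h5]
    have h6 : w * |x| ≤ Λ / 4 := by nlinarith [abs_nonneg x]
    linarith

/-- **THE FRAME RESPONSE OF THE RESUMMED SYMBOL**: for `0 < c`, `0 < Λ`, `ω ≠ 0`, `|x|, |x′| ≤ Λ/4` and `B₁ ≥ sup|χ₂′|`: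
`‖Ψ̃(x) − Ψ̃(x′)‖ ≤ c·(200 + 200B₁)/Λ²·|x − x′|` (zero when both points are below or both above the shell; on the shell the
denominators are `≥ Λ/10` and the weight is `B₁`-Lipschitz). [cite: BenfattoGiulianiMastropietro2006, §2.2 (2.23), (2.27)–(2.28)] -/
theorem norm_uvResummedFn_sub_le {B₁ : ℝ} (hB0 : 0 ≤ B₁) (hB : ∀ y, |deriv salmhoferCutoff y| ≤ B₁) {c Λ ω : ℝ} (hc : 0 < c)
    (hΛ : 0 < Λ) (hω : ω ≠ 0) (ξ : ℝ) {x x' : ℝ} (hx : |x| ≤ Λ / 4) (hx' : |x'| ≤ Λ / 4) :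
    ‖uvResummedFn c Λ ω ξ x - uvResummedFn c Λ ω ξ x'‖ ≤ c * (200 + 200 * B₁) / Λ ^ 2 * |x - x'| := by
  have hc0 : c ≠ 0 := hc.ne'
  set w := uvWeightFn Λ (ξ - x) ω with hwdef
  set w' := uvWeightFn Λ (ξ - x') ω with hw'def
  have hw : w ∈ Set.Icc (0:ℝ) 1 := uvWeightFn_mem_Icc _ _ _
  have hwp : w' ∈ Set.Icc (0:ℝ) 1 := uvWeightFn_mem_Icc _ _ _
  set a := ω ^ 2 + (ξ - x) ^ 2 with ha
  set a' := ω ^ 2 + (ξ - x') ^ 2 with ha'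
  have hRHS0 : 0 ≤ c * (200 + 200 * B₁) / Λ ^ 2 * |x - x'| := by positivity
  -- the weight difference, when at least one point is below `Λ²`
  have hwdiff : a < Λ ^ 2 ∨ a' < Λ ^ 2 → |w - w'| ≤ 5 / 2 * B₁ * |x - x'| / Λ := by
    intro hlt
    have h1 := abs_uvWeightFn_sub_le hB hΛ (ξ - x) (ξ - x') ω
    have hfac : (ξ - x) ^ 2 - (ξ - x') ^ 2 = (x' - x) * (2 * ξ - x - x') := by ring
    have hbound : |2 * ξ - x - x'| ≤ 5 / 2 * Λ := by
      have hxx : |x - x'| ≤ Λ / 2 := by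
        have := abs_sub x x'; linarith
      rcases hlt with h | h
      · have he : |ξ - x| < Λ := by
          have : (ξ - x) ^ 2 < Λ ^ 2 := by nlinarith [sq_nonneg ω]
          exact abs_lt_of_sq_lt_sq this hΛ.le
        have : 2 * ξ - x - x' = 2 * (ξ - x) + (x - x') := by ring
        rw [this]
        have := abs_add_le (2 * (ξ - x)) (x - x')
        rw [abs_mul, abs_two] at this
        linarith
      · have he : |ξ - x'| < Λ := by
          have : (ξ - x') ^ 2 < Λ ^ 2 := by nlinarith [sq_nonneg ω]
          exact abs_lt_of_sq_lt_sq this hΛ.le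
        have : 2 * ξ - x - x' = 2 * (ξ - x') + (x' - x) := by ring
        rw [this]
        have := abs_add_le (2 * (ξ - x')) (x' - x)
        rw [abs_mul, abs_two, abs_sub_comm x' x] at this
        linarith
    calc |w - w'| ≤ B₁ * |(ξ - x) ^ 2 - (ξ - x') ^ 2| / Λ ^ 2 := h1
      _ = B₁ * (|x - x'| * |2 * ξ - x - x'|) / Λ ^ 2 := by rw [hfac, abs_mul, abs_sub_comm x' x]
      _ ≤ B₁ * (|x - x'| * (5 / 2 * Λ)) / Λ ^ 2 := by gcongr
      _ = 5 / 2 * B₁ * |x - x'| / Λ := by field_simp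
  by_cases hA : a ≤ Λ ^ 2 / 4
  · -- `x` below the shell: `Ψ̃(x) = 0`
    have hwx : w = 0 := uvWeightFn_eq_zero_of_le hΛ hA
    rw [uvResummedFn_eq_zero_of_weight hc0 hω hwx]
    by_cases hA' : a' ≤ Λ ^ 2 / 4
    · rw [uvResummedFn_eq_zero_of_weight hc0 hω (uvWeightFn_eq_zero_of_le hΛ hA'), sub_self, norm_zero]
      exact hRHS0
    · push Not at hA'
      rw [zero_sub, norm_neg, uvResummedFn_eq hc0 hω]
      have hD := norm_resummedDen_ge hΛ (ω := ω) (ξ := ξ) hx' hwp.1 hwp.2 hA'.le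
      have hDpos : 0 < ‖-I * (ω : ℂ) + (ξ : ℂ) - (1 - (w' : ℂ)) * (x' : ℂ)‖ := lt_of_lt_of_le (by positivity) hD
      rw [norm_div, norm_mul, Complex.norm_real, Complex.norm_real, Real.norm_eq_abs, Real.norm_eq_abs, abs_of_pos hc,
        abs_of_nonneg hwp.1]
      -- `w' = w' − w ≤ (5/2)B₁|x−x'|/Λ` (here `a < Λ²` since `a ≤ Λ²/4`)
      have hw'le : w' ≤ 5 / 2 * B₁ * |x - x'| / Λ := by
        have h := hwdiff (Or.inl (by nlinarith))
        rw [hwx, zero_sub, abs_neg, abs_of_nonneg hwp.1] at h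
        exact h
      calc c * w' / ‖-I * (ω : ℂ) + (ξ : ℂ) - (1 - (w' : ℂ)) * (x' : ℂ)‖
          ≤ c * (5 / 2 * B₁ * |x - x'| / Λ) / (Λ / 10) := by
            gcongr
        _ = c * (25 * B₁) / Λ ^ 2 * |x - x'| := by field_simp; ring
        _ ≤ c * (200 + 200 * B₁) / Λ ^ 2 * |x - x'| := by
            gcongr; nlinarith
  · push Not at hA
    by_cases hA' : a' ≤ Λ ^ 2 / 4
    · -- symmetric case: `x'` below the shell
      have hwx' : w' = 0 := uvWeightFn_eq_zero_of_le hΛ hA'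
      rw [uvResummedFn_eq_zero_of_weight hc0 hω hwx', sub_zero, uvResummedFn_eq hc0 hω]
      have hD := norm_resummedDen_ge hΛ (ω := ω) (ξ := ξ) hx hw.1 hw.2 hA.le
      rw [norm_div, norm_mul, Complex.norm_real, Complex.norm_real, Real.norm_eq_abs, Real.norm_eq_abs, abs_of_pos hc,
        abs_of_nonneg hw.1]
      have hwle : w ≤ 5 / 2 * B₁ * |x - x'| / Λ := by
        have h := hwdiff (Or.inr (by nlinarith))
        rw [hwx', sub_zero, abs_of_nonneg hw.1] at h
        exact h
      calc c * w / ‖-I * (ω : ℂ) + (ξ : ℂ) - (1 - (w : ℂ)) * (x : ℂ)‖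
          ≤ c * (5 / 2 * B₁ * |x - x'| / Λ) / (Λ / 10) := by
            gcongr
        _ = c * (25 * B₁) / Λ ^ 2 * |x - x'| := by field_simp; ring
        _ ≤ c * (200 + 200 * B₁) / Λ ^ 2 * |x - x'| := by
            gcongr; nlinarith
    · -- both on or above the shell: algebra with both denominators `≥ Λ/10`
      push Not at hA'
      by_cases hboth : Λ ^ 2 ≤ a ∧ Λ ^ 2 ≤ a'
      · rw [uvResummedFn_sub_eq_zero_of_weights_one hc0 hω (uvWeightFn_eq_one_of_ge hΛ hboth.1)
          (uvWeightFn_eq_one_of_ge hΛ hboth.2), norm_zero]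
        exact hRHS0
      · have hlt : a < Λ ^ 2 ∨ a' < Λ ^ 2 := by
          by_contra h; push Not at h; exact hboth h
        have hwd := hwdiff hlt
        set D : ℂ := -I * (ω : ℂ) + (ξ : ℂ) - (1 - (w : ℂ)) * (x : ℂ) with hDdef
        set D' : ℂ := -I * (ω : ℂ) + (ξ : ℂ) - (1 - (w' : ℂ)) * (x' : ℂ) with hD'def
        have hD := norm_resummedDen_ge hΛ (ω := ω) (ξ := ξ) hx hw.1 hw.2 hA.le
        have hD' := norm_resummedDen_ge hΛ (ω := ω) (ξ := ξ) hx' hwp.1 hwp.2 hA'.le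
        have hDpos : 0 < ‖D‖ := lt_of_lt_of_le (by positivity) hD
        have hD'pos : 0 < ‖D'‖ := lt_of_lt_of_le (by positivity) hD'
        have hDne : D ≠ 0 := norm_pos_iff.1 hDpos
        have hD'ne : D' ≠ 0 := norm_pos_iff.1 hD'pos
        rw [uvResummedFn_eq hc0 hω, uvResummedFn_eq hc0 hω]
        change ‖(c : ℂ) * (w : ℂ) / D - (c : ℂ) * (w' : ℂ) / D'‖ ≤ _
        have halg : (c : ℂ) * (w : ℂ) / D - (c : ℂ) * (w' : ℂ) / D' =
            (c : ℂ) * (((w : ℂ) - (w' : ℂ)) / D + (w' : ℂ) * (D' - D) / (D * D')) := by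
          field_simp
          ring
        have hDD : D' - D = ((x - x' : ℝ) : ℂ) - ((w : ℂ) * (x : ℂ) - (w' : ℂ) * (x' : ℂ)) := by
          simp only [hDdef, hD'def]; push_cast; ring
        have hwx : ‖(w : ℂ) * (x : ℂ) - (w' : ℂ) * (x' : ℂ)‖ ≤ |x - x'| + Λ / 4 * |w - w'| := by
          have : (w : ℂ) * (x : ℂ) - (w' : ℂ) * (x' : ℂ) = (w' : ℂ) * ((x : ℂ) - (x' : ℂ)) + ((w : ℂ) - (w' : ℂ)) * (x : ℂ) := by ring
          rw [this]
          refine (norm_add_le _ _).trans ?_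
          rw [norm_mul, norm_mul, ← Complex.ofReal_sub, ← Complex.ofReal_sub, Complex.norm_real, Complex.norm_real,
            Complex.norm_real, Complex.norm_real, Real.norm_eq_abs, Real.norm_eq_abs, Real.norm_eq_abs, Real.norm_eq_abs,
            abs_of_nonneg hwp.1]
          have h1 : w' * |x - x'| ≤ |x - x'| := by nlinarith [abs_nonneg (x - x'), hwp.2]
          have h2 : |w - w'| * |x| ≤ Λ / 4 * |w - w'| := by nlinarith [abs_nonneg (w - w')]
          linarith
        have hnDD : ‖D' - D‖ ≤ 2 * |x - x'| + Λ / 4 * |w - w'| := by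
          rw [hDD]
          refine (norm_sub_le _ _).trans ?_
          rw [Complex.norm_real, Real.norm_eq_abs]
          linarith [abs_nonneg (x - x')]
        have hnum1 : ‖((w : ℂ) - (w' : ℂ)) / D‖ ≤ (5 / 2 * B₁ * |x - x'| / Λ) / (Λ / 10) := by
          rw [norm_div, ← Complex.ofReal_sub, Complex.norm_real, Real.norm_eq_abs]
          gcongr
        have hnum2 : ‖(w' : ℂ) * (D' - D) / (D * D')‖ ≤ (2 * |x - x'| + Λ / 4 * (5 / 2 * B₁ * |x - x'| / Λ)) / (Λ / 10 * (Λ / 10)) := by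
          rw [norm_div, norm_mul, norm_mul, Complex.norm_real, Real.norm_eq_abs, abs_of_nonneg hwp.1]
          have : w' * ‖D' - D‖ ≤ 2 * |x - x'| + Λ / 4 * (5 / 2 * B₁ * |x - x'| / Λ) := by
            calc w' * ‖D' - D‖ ≤ 1 * ‖D' - D‖ := by gcongr; exact hwp.2
              _ ≤ 2 * |x - x'| + Λ / 4 * |w - w'| := by rw [one_mul]; exact hnDD
              _ ≤ _ := by gcongr
          calc w' * ‖D' - D‖ / (‖D‖ * ‖D'‖) ≤ (2 * |x - x'| + Λ / 4 * (5 / 2 * B₁ * |x - x'| / Λ)) / (‖D‖ * ‖D'‖) := by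
                gcongr
            _ ≤ _ := by
                apply div_le_div_of_nonneg_left (by positivity) (by positivity)
                exact mul_le_mul hD hD' (by positivity) (norm_nonneg _)
        rw [halg, norm_mul, Complex.norm_real, Real.norm_eq_abs, abs_of_pos hc]
        calc c * ‖((w : ℂ) - (w' : ℂ)) / D + (w' : ℂ) * (D' - D) / (D * D')‖
            ≤ c * ((5 / 2 * B₁ * |x - x'| / Λ) / (Λ / 10) +
                (2 * |x - x'| + Λ / 4 * (5 / 2 * B₁ * |x - x'| / Λ)) / (Λ / 10 * (Λ / 10))) := by
              gcongr
              exact (norm_add_le _ _).trans (add_le_add hnum1 hnum2)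
          _ = c * (200 + 175 / 2 * B₁) / Λ ^ 2 * |x - x'| := by field_simp; ring
          _ ≤ c * (200 + 200 * B₁) / Λ ^ 2 * |x - x'| := by gcongr; nlinarith


/-! ## §3 (appended) The sup size of the resummed symbol and the external-leg DRESSING FACTOR `m = (1 + Ψ·x/c)⁻¹`

Absorbing the diagonal quadratic `x·ψ⁺ψ⁻/c` into the Gaussian measure dresses every EXTERNAL leg of the remaining effective action by
`m = (1 + Ψ·x/c)⁻¹` (Benfatto–Giuliani–Mastropietro 2006 (2.21)–(2.24): the legs of the kernels carry the ratio of the dressed to the undressed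
propagator).  Since `Ψ̃ = Ψ/(1 + Ψ·x/c)`, the defect of the dressing factor is `m − 1 = −(x/c)·Ψ̃`, so it is controlled by the SUP size of the
resummed symbol: `‖Ψ̃‖ ≤ 10·c/Λ` (zero below the shell; on and above it `w ≤ 1` and the resummed denominator is `≥ Λ/10`), whence
`‖m − 1‖ ≤ 10·|x|/Λ` for `|x| ≤ Λ/4` — first order in the frame value, uniformly in the frequency (cell gate-hubbard-kl: the dressing term of the
four-leg frame-shift response, `…EngineFrameShiftResponseFourLegAmplitude`). -/

/-- The resummation denominator `1 + Ψ(ξ − x)·(x/c)` never vanishes (`c ≠ 0`, `ω ≠ 0`): multiplied by `−iω + ξ − x ≠ 0` it becomes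
`−iω + ξ − (1 − w)·x`, whose imaginary part is `−ω`. [cite: BenfattoGiulianiMastropietro2006, §2.2 (2.23)] -/
theorem one_add_uvSymbolFn_mul_ne_zero {c ω : ℝ} (hc : c ≠ 0) (hω : ω ≠ 0) (Λ ξ x : ℝ) :
    1 + uvSymbolFn c Λ (ξ - x) ω * ((x / c : ℝ) : ℂ) ≠ 0 := by
  have hD : -I * ((ω + 0 : ℝ) : ℂ) + ((ξ - x : ℝ) : ℂ) ≠ 0 := uvDen_ne_zero hω _
  have hc' : (c : ℂ) ≠ 0 := by exact_mod_cast hc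
  unfold uvSymbolFn resolventFn
  set w : ℝ := uvWeightFn Λ (ξ - x) ω
  have hD2 : -I * (ω : ℂ) + (ξ : ℂ) - (1 - (w : ℂ)) * (x : ℂ) ≠ 0 := by
    intro h
    have := congrArg Complex.im h
    simp at this
    exact hω this
  have hD' : -(I * (ω : ℂ)) + (ξ : ℂ) - (x : ℂ) ≠ 0 := by
    intro h
    have := congrArg Complex.im h
    simp at this
    exact hω this
  have hD'' : -(I * (ω : ℂ)) + ((ξ : ℂ) - (x : ℂ)) ≠ 0 := by rwa [← add_sub_assoc]
  have key : (1 : ℂ) + (w : ℂ) * ((c : ℂ) / (-I * ((ω + 0 : ℝ) : ℂ) + ((ξ - x : ℝ) : ℂ))) * ((x / c : ℝ) : ℂ) =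
      (-I * (ω : ℂ) + (ξ : ℂ) - (1 - (w : ℂ)) * (x : ℂ)) / (-I * ((ω + 0 : ℝ) : ℂ) + ((ξ - x : ℝ) : ℂ)) := by
    rw [eq_div_iff hD]
    push_cast
    simp only [add_zero, neg_mul]
    field_simp
    ring
  rw [key]
  exact div_ne_zero hD2 hD

/-- **Sup bound of the resummed symbol**: for `0 < c`, `0 < Λ`, `ω ≠ 0` and `|x| ≤ Λ/4`, `‖Ψ̃‖ ≤ 10·c/Λ` — below the shell `Ψ̃ = 0`; on and above
it `Ψ̃ = c·w/(−iω + ξ − (1−w)x)` with `0 ≤ w ≤ 1` and the denominator `≥ Λ/10` (`norm_resummedDen_ge`).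
[cite: BenfattoGiulianiMastropietro2006, §2.2 (2.23), (2.27)–(2.28)] -/
theorem norm_uvResummedFn_le {c Λ ω : ℝ} (hc : 0 < c) (hΛ : 0 < Λ) (hω : ω ≠ 0) (ξ : ℝ) {x : ℝ} (hx : |x| ≤ Λ / 4) :
    ‖uvResummedFn c Λ ω ξ x‖ ≤ 10 * c / Λ := by
  have hw : uvWeightFn Λ (ξ - x) ω ∈ Set.Icc (0 : ℝ) 1 := uvWeightFn_mem_Icc _ _ _
  by_cases hA : ω ^ 2 + (ξ - x) ^ 2 ≤ Λ ^ 2 / 4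
  · rw [uvResummedFn_eq_zero_of_weight hc.ne' hω (uvWeightFn_eq_zero_of_le hΛ hA), norm_zero]
    positivity
  · have hden := norm_resummedDen_ge hΛ hx hw.1 hw.2 (not_le.1 hA).le
    have hden0 : 0 < ‖-I * (ω : ℂ) + (ξ : ℂ) - (1 - (uvWeightFn Λ (ξ - x) ω : ℂ)) * (x : ℂ)‖ := lt_of_lt_of_le (by positivity) hden
    rw [uvResummedFn_eq hc.ne' hω, norm_div, norm_mul, Complex.norm_real, Complex.norm_real, Real.norm_of_nonneg hc.le,
      Real.norm_of_nonneg hw.1, div_le_div_iff₀ hden0 hΛ]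
    calc c * uvWeightFn Λ (ξ - x) ω * Λ ≤ c * 1 * Λ := by gcongr; exact hw.2
      _ = c * (10 * (Λ / 10)) := by ring
      _ ≤ c * (10 * ‖-I * (ω : ℂ) + (ξ : ℂ) - (1 - (uvWeightFn Λ (ξ - x) ω : ℂ)) * (x : ℂ)‖) := by gcongr
      _ = 10 * c * _ := by ring

/-- **The dressing factor's defect is `−(x/c)·Ψ̃`**: `(1 + Ψ(ξ−x)·x/c)⁻¹ − 1 = −((x/c)·Ψ̃)` (`c ≠ 0`, `ω ≠ 0`).
[cite: BenfattoGiulianiMastropietro2006, §2.2 (2.21)–(2.24)] -/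
theorem inv_one_add_uvSymbolFn_mul_sub_one {c ω : ℝ} (hc : c ≠ 0) (hω : ω ≠ 0) (Λ ξ x : ℝ) :
    (1 + uvSymbolFn c Λ (ξ - x) ω * ((x / c : ℝ) : ℂ))⁻¹ - 1 = -(((x / c : ℝ) : ℂ) * uvResummedFn c Λ ω ξ x) := by
  have hz := one_add_uvSymbolFn_mul_ne_zero hc hω Λ ξ x
  unfold uvResummedFn
  field_simp
  ring

/-- **The dressing factor is within `10·|x|/Λ` of `1`**: for `0 < c`, `0 < Λ`, `ω ≠ 0`, `|x| ≤ Λ/4`,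
`‖(1 + Ψ(ξ−x)·x/c)⁻¹ − 1‖ ≤ 10·|x|/Λ` — FIRST order in the frame value, uniformly in `ω`, `ξ`, `c`.
[cite: BenfattoGiulianiMastropietro2006, §2.2 (2.21)–(2.24), (2.27)–(2.28)] -/
theorem norm_inv_one_add_uvSymbolFn_mul_sub_one_le {c Λ ω : ℝ} (hc : 0 < c) (hΛ : 0 < Λ) (hω : ω ≠ 0) (ξ : ℝ) {x : ℝ} (hx : |x| ≤ Λ / 4) :
    ‖(1 + uvSymbolFn c Λ (ξ - x) ω * ((x / c : ℝ) : ℂ))⁻¹ - 1‖ ≤ 10 * |x| / Λ := by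
  rw [inv_one_add_uvSymbolFn_mul_sub_one hc.ne' hω, norm_neg, norm_mul, Complex.norm_real, Real.norm_eq_abs, abs_div, abs_of_pos hc]
  calc |x| / c * ‖uvResummedFn c Λ ω ξ x‖ ≤ |x| / c * (10 * c / Λ) := by gcongr; exact norm_uvResummedFn_le hc hΛ hω ξ hx
    _ = 10 * |x| / Λ := by field_simp

end Literature.MathematicalPhysics.QuantumLattice

end
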